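import Mathlib
import Summits.CriticalPhenomena.PercolationContinuityZ3.Theses.PercMinContact

/-!
# Route PercMinContact — assembly item `Assembly`

`SwallowInequality → SwallowTail → PercolationContinuityZ3`.

Pure measure theory plus `p_c(ℤ³) < 1` (Grimmett 1999 §1.4, proved in the tree as
`Literature.Probability.Percolation.Grimmett1999_criticalProb_pos_lt_one_holds`): if `θ(p_c) > 0`,
`SwallowTail` gives `p₀ < p_c` with `∫_{(p₀,p_c)} m < ∞`; absolute continuity of this finite
set-integral (`MeasureTheory.exists_pos_setLIntegral_lt_of_measure_lt`, no measurability of `m`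
needed) gives `p ∈ [p₀, p_c)` with `∫_{(p,p_c)} m < (1 - p_c) θ(p_c)`; `SwallowInequality` at `p`
and `(1-u)⁻¹ ≤ (1-p_c)⁻¹` on `(p, p_c)` give `θ(p_c) ≤ (1-p_c)⁻¹ ∫_{(p,p_c)} m < θ(p_c)`,
a contradiction; `θ ≥ 0` finishes. This is verbatim the argument of the route's deciding theorem
`closes`, whose only used hypotheses are `SwallowTail` and `SwallowInequality`.
-/

namespace Summit.CriticalPhenomena.PercolationContinuityZ3.Theorems

open MeasureTheory Set

/-- Real-analysis core of the assembly, generic in the integrand `m : ℝ → [0,∞]`: if `pc < 1`,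
`0 ≤ θc`, the tail integral `∫_{(p₀,pc)} m` is finite for some `p₀ < pc`, and the swallow
inequality `ofReal θc ≤ ∫_{(p,pc)} ofReal ((1-u)⁻¹) * m u` holds for every `p < pc`, then
`θc = 0`. -/
theorem percMinContact_theta_eq_zero_of_tail_finite (m : ℝ → ENNReal) (pc θc p₀ : ℝ)
    (hpc1 : pc < 1) (hθ0 : 0 ≤ θc) (hp₀ : p₀ < pc) (hfin : (∫⁻ u in Set.Ioo p₀ pc, m u) < ⊤)
    (hineq : ∀ p : ℝ, p < pc → ENNReal.ofReal θc ≤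
        ∫⁻ u in Set.Ioo p pc, ENNReal.ofReal ((1 - u)⁻¹) * m u) : θc = 0 := by
  by_contra hne
  have hθpos : 0 < θc := lt_of_le_of_ne hθ0 (Ne.symm hne)
  have h1pc : 0 < 1 - pc := sub_pos.2 hpc1
  have hεne : ENNReal.ofReal ((1 - pc) * θc) ≠ 0 :=
    (ENNReal.ofReal_pos.2 (mul_pos h1pc hθpos)).ne'
  obtain ⟨δ, hδpos, hδ⟩ := MeasureTheory.exists_pos_setLIntegral_lt_of_measure_lt
    (μ := volume.restrict (Set.Ioo p₀ pc)) (f := m) hfin.ne hεne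
  -- a level `p ∈ [p₀, pc)` with `pc - p` small
  obtain ⟨p, hp₀p, hppc, hsmall⟩ :
      ∃ p : ℝ, p₀ ≤ p ∧ p < pc ∧ ENNReal.ofReal (pc - p) < δ := by
    rcases eq_or_ne δ ⊤ with hδtop | hδtop
    · exact ⟨p₀, le_rfl, hp₀, by rw [hδtop]; exact ENNReal.ofReal_lt_top⟩
    · have hdpos : 0 < δ.toReal := ENNReal.toReal_pos hδpos.ne' hδtop
      refine ⟨max p₀ (pc - δ.toReal / 2), le_max_left _ _, max_lt hp₀ (by linarith), ?_⟩
      have hle : pc - max p₀ (pc - δ.toReal / 2) ≤ δ.toReal / 2 := by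
        have := le_max_right p₀ (pc - δ.toReal / 2)
        linarith
      calc ENNReal.ofReal (pc - max p₀ (pc - δ.toReal / 2))
          ≤ ENNReal.ofReal (δ.toReal / 2) := ENNReal.ofReal_le_ofReal hle
        _ < ENNReal.ofReal δ.toReal := (ENNReal.ofReal_lt_ofReal_iff hdpos).2 (by linarith)
        _ = δ := ENNReal.ofReal_toReal hδtop
  -- the restricted measure of the tail interval is small
  have hinter : Set.Ioo p pc ∩ Set.Ioo p₀ pc = Set.Ioo p pc :=
    Set.inter_eq_left.2 (Set.Ioo_subset_Ioo_left hp₀p)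
  have hμs : (volume.restrict (Set.Ioo p₀ pc)) (Set.Ioo p pc) < δ := by
    rw [Measure.restrict_apply measurableSet_Ioo, hinter, Real.volume_Ioo]
    exact hsmall
  have htail : ∫⁻ u in Set.Ioo p pc, m u < ENNReal.ofReal ((1 - pc) * θc) := by
    have h := hδ (Set.Ioo p pc) hμs
    rwa [Measure.restrict_restrict measurableSet_Ioo, hinter] at h
  -- the weight `(1 - u)⁻¹ ≤ (1 - pc)⁻¹` on `(p, pc)`
  have hW : ∀ u ∈ Set.Ioo p pc,
      ENNReal.ofReal ((1 - u)⁻¹) * m u ≤ ENNReal.ofReal ((1 - pc)⁻¹) * m u := by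
    intro u hu
    exact mul_le_mul' (ENNReal.ofReal_le_ofReal (inv_anti₀ h1pc (by linarith [hu.2]))) le_rfl
  have hWtop : ENNReal.ofReal ((1 - pc)⁻¹) ≠ ⊤ := ENNReal.ofReal_ne_top
  have hWpos : ENNReal.ofReal ((1 - pc)⁻¹) ≠ 0 :=
    (ENNReal.ofReal_pos.2 (inv_pos.2 h1pc)).ne'
  have hchain : ENNReal.ofReal θc < ENNReal.ofReal θc :=
    calc ENNReal.ofReal θc
        ≤ ∫⁻ u in Set.Ioo p pc, ENNReal.ofReal ((1 - u)⁻¹) * m u := hineq p hppc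
      _ ≤ ∫⁻ u in Set.Ioo p pc, ENNReal.ofReal ((1 - pc)⁻¹) * m u :=
          setLIntegral_mono' measurableSet_Ioo hW
      _ = ENNReal.ofReal ((1 - pc)⁻¹) * ∫⁻ u in Set.Ioo p pc, m u :=
          lintegral_const_mul' _ _ hWtop
      _ < ENNReal.ofReal ((1 - pc)⁻¹) * ENNReal.ofReal ((1 - pc) * θc) :=
          ENNReal.mul_lt_mul_right hWpos hWtop htail
      _ = ENNReal.ofReal ((1 - pc)⁻¹ * ((1 - pc) * θc)) :=
          (ENNReal.ofReal_mul (inv_nonneg.2 h1pc.le)).symm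
      _ = ENNReal.ofReal θc := by
          congr 1
          field_simp
  exact lt_irrefl _ hchain

/-- **Assembly** (route PercMinContact, item stmt-CriticalPhenomena-11504):
`SwallowInequality → SwallowTail → PercolationContinuityZ3`. Instantiate the real-analysis core
`percMinContact_theta_eq_zero_of_tail_finite` with `pc = p_c(ℤ³) < 1`
(`Grimmett1999_criticalProb_pos_lt_one_holds`), `θc = θ(p_c) ≥ 0`, the min-contact function as
`m`, the witness `p₀` of `SwallowTail`, and `SwallowInequality`. -/
theorem percMinContactAssembly_proof :
    Summit.CriticalPhenomena.PercolationContinuityZ3.Theses.PercMinContact.Assembly := by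
  unfold Summit.CriticalPhenomena.PercolationContinuityZ3.Theses.PercMinContact.Assembly
    Summit.CriticalPhenomena.PercolationContinuityZ3.Theses.PercMinContact.SwallowInequality
    Summit.CriticalPhenomena.PercolationContinuityZ3.Theses.PercMinContact.SwallowTail
  intro h_SwallowInequality h_SwallowTail
  have hpc1 : Literature.Probability.Percolation.criticalProb
      (Literature.Probability.LatticeModels.zdGraph 3)
      (0 : Literature.Probability.LatticeModels.Site 3) < 1 :=
    (Literature.Probability.Percolation.Grimmett1999_criticalProb_pos_lt_one_holds 3 (by norm_num)).2
  obtain ⟨p₀, hp₀, hfin⟩ := h_SwallowTail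
  exact Literature.Probability.Percolation.percolationContinuityZ3_iff.mpr
    (percMinContact_theta_eq_zero_of_tail_finite _ _
      (Literature.Probability.Percolation.theta (Literature.Probability.LatticeModels.zdGraph 3) 0
        (Literature.Probability.Percolation.criticalProbI 3)) p₀ hpc1 measureReal_nonneg hp₀ hfin
      h_SwallowInequality)

end Summit.CriticalPhenomena.PercolationContinuityZ3.Theorems
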